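import Summits.AtomisticToContinuum.Crystallization.Theorems.ExcessDecayLiouvilleCurrenciesSum
import Summits.AtomisticToContinuum.Crystallization.Theorems.ExcessDecayLiouvilleLinearSup
/-!
# Route `ExcessDecayLiouville`: the base values of the step field by the harmonic sup estimate (nonlinear half, XXXVI)

Harmonic-replacement architecture for item `ExcessDecay` (stmt-AtomisticToContinuum-9334), nonlinear half.
`step_values`: for `h = v + w` lattice-harmonic on `B_{ρ′}(c₀)` (`ρ′ = 2(1280·9ρ + 2388) + 4`), at the sites of
`B_ρ(c₀)`, `‖h(x)‖² ≤ 64 L³/ρ³ · (2 M_sh + 2 W) + 536 L³ ρ³ · (2 J_v + 2 (10ρ+10)⁻⁸ W)` where `M_sh` bounds the sharp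
mass `M[v, R_M]`, `J_v` the far mass `J[v, 10ρ + 10]` and `W = Σ'‖w‖²` (`sup_sq_le_of_harmonic` with `R = ρ`,
`mass_add_le`, `farMass_add_le`).  The correction enters with the gain `ρ⁻³` — this is how the ε-free forcing floor
stays `O(r⁻²)` in the base values (`induction_step₂`).
All `[folklore]`; helper lemmas, nothing here closes an item.
-/

noncomputable section

namespace Summit.AtomisticToContinuum.Crystallization.Theorems.ExcessDecayLiouville

open scoped BigOperators Topology InnerProductSpace RealInnerProductSpace Classical
open Literature.MathematicalPhysics.StatisticalMechanics
open Summit.AtomisticToContinuum.Crystallization.Theorems.PhononStabilityNegative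

local notation "E3" => EuclideanSpace ℝ (Fin 3)

-- Local notation: the force-constant map `K(e)w = h(|e|²)w + 2⟪e,w⟫h′(|e|²)e`.
local notation3 "𝕂[" e "] " w:max =>
  (-((‖e‖ ^ 2)⁻¹) ^ 7 + ((‖e‖ ^ 2)⁻¹) ^ 4) • w + (2 * ⟪e, w⟫ * (7 * ((‖e‖ ^ 2)⁻¹) ^ 8 - 4 * ((‖e‖ ^ 2)⁻¹) ^ 5)) • e
-- Local notation: the pair force `F(x) = h(|x|²) x`.
local notation3 "𝐅[" x "]" => ((-((‖x‖ ^ 2)⁻¹) ^ 7 + ((‖x‖ ^ 2)⁻¹) ^ 4) • x)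
set_option quotPrecheck false in
-- Local notation: ball indicator.
local notation "𝟙ᵇ[" x ", " c ", " R "]" => (if dist (x : EuclideanSpace ℝ (Fin 3)) c ≤ R then (1 : ℝ) else 0)
-- the constants of one level in mass form
local notation "Cₐ" => (19 * (1024 / ((23 / 25 : ℝ) ^ 3 * (23 / 25 : ℝ) ^ 3)) + 38 * (1024 / (23 / 25 : ℝ) ^ 3))
local notation "Cⱼ" => (9961472 : ℝ)
-- the two Lipschitz constants of the natural force
local notation "Cˢ" => (38 * (25 / 23) * (1024 / ((23 / 25 : ℝ) ^ 3 * (23 / 25 : ℝ) ^ 4)) +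
  (1024 / ((23 / 25 : ℝ) ^ 3 * (23 / 25 : ℝ) ^ 4)) * ((25 / 23 : ℝ) ^ 2 * (72 + 2000)))
local notation "Cᴮ" => (5660 * (1024 / ((23 / 25 : ℝ) ^ 3 * (23 / 25 : ℝ) ^ 3)))
-- the gradient currency as a quintic: coefficients (as in `StepEnergyBound`)
local notation "𝔮₁[" κ ", " Λ' ", " C "]" => ((64 * (2 / κ) * (131072 * (38 * 4 ^ 5 * (1024 / (23 / 25 : ℝ) ^ 3)) +
          Λ' * 3200000 * (1024 / (23 / 25 : ℝ) ^ 3) * 72704) * C + 64 * 120 ^ 5 * 327680 * C +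
        4 / κ * (Λ' * 32768 * 256 * C + 1245184 * 4096 * C)))
local notation "𝔮₂[" κ ", " Λ' ", " Dv ", " r "]" => ((4 / κ * (Λ' * 32768 * 8192 * (7 * r / 8) ^ 3 * Dv ^ 2 / ((r / 4) ^ 7 * 4) +
        1245184 * 8192 * (7 * r / 8) ^ 3 * Dv ^ 2 / (r / 4) ^ 7)))
local notation "𝔮₃[" κ ", " Λ' ", " D₀ ", " r "]" => ((4 / κ * (Λ' * 32768 * (32 * r ^ 3 * ((3 * r / 8)⁻¹ ^ 8 * (D₀ / 2) ^ 2)))))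
local notation "𝔮₄[" κ ", " C "]" => ((2 ^ (5 + 1) * (2 / κ * (19 * 16 * (1024 / ((23 / 25 : ℝ) ^ 3 * (23 / 25 : ℝ) ^ 3))) +
        16 * (11 / 10 : ℝ) ^ 8 * (1024 / ((23 / 25 : ℝ) ^ 3 * (23 / 25 : ℝ) ^ 3))) * (32 * 4 ^ 6) * C))
local notation "𝔮₅[" κ ", " C ", " Φ₀ "]" => ((4 / κ * (16 * Real.sqrt (2048 * C) * Φ₀)))
set_option quotPrecheck false in
-- the forcing constant on `B_{r/4}(c)`
local notation "𝚽[" Du ", " r ", " δ "]" => (31488 * (1024 / ((23 / 25 : ℝ) ^ 3 * (r / 2) ^ 4)) + 2048 / (δ ^ 3 * (r / 4) ^ 4) +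
        (38 * Du * (1024 / ((23 / 25 : ℝ) ^ 3 * (r / 4) ^ 5)) + 38 * Du * (1024 / ((23 / 25 : ℝ) ^ 3 * (r / 2) ^ 5))))

section

variable {X : Set E3} {c : E3} {r ε δ κ : ℝ} {t : Fin 2 → E3} {A : E3 →L[ℝ] E3} {π : E3 → E3}
  {aff : E3 → E3} {a : Fin 2 → E3} {B : E3 →L[ℝ] E3} {c₀ : E3}

variable (hA : Adm₀ A) (hI : Inner₀ t A)

set_option quotPrecheck false in
-- Local notation: the operator row `(L v)(p)`.
local notation "𝕃" v:max " @ " p:max =>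
  tsum (fun q : Sites₀ t A => (if ((p : Sites₀ t A) : E3) ≠ q then 𝕂[((p : Sites₀ t A) : E3) - q] (v ((p : Sites₀ t A) : E3) - v q) else 0))
set_option quotPrecheck false in
-- Local notation: the finite near-neighbour form on the ball of radius `X` about `c₀`.
local notation "NN[" v ", " X "]" =>
  (∑ p ∈ (finite_sites_dist_le (t := t) (A := A) hA hI c₀ X).toFinset,
    ∑ q ∈ (finite_sites_dist_le (t := t) (A := A) hA hI c₀ X).toFinset,
      (if p ≠ q ∧ dist p q ≤ 11 / 10 then ‖v p - v q‖ ^ 2 else (0 : ℝ)))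
set_option quotPrecheck false in
-- local mass on the ball of radius `X` about `c₀`
local notation "𝐌[" f ", " X "]" =>
  tsum (fun p : Sites₀ t A => ‖f (p : E3)‖ ^ 2 * 𝟙ᵇ[p, c₀, X])
set_option quotPrecheck false in
-- the level constant `L = (4Cₐ + 24Cⱼ)/κ + 1`
local notation "𝐋" => ((4 * Cₐ + 24 * Cⱼ) / κ + 1)
set_option quotPrecheck false in
-- Local notation: the displaced self-force `G(p)` of the background `aff`.
local notation "𝐆[" aff "] " p:max =>
  tsum (fun q : Sites₀ t A => (if (p : E3) ≠ q then 𝐅[((p : E3) - q) + (aff (p : E3) - aff q)] else 0))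

set_option quotPrecheck false in
-- weighted far mass about `c₀`
local notation "𝐉[" f ", " Y "]" =>
  tsum (fun q : Sites₀ t A => ‖f (q : E3)‖ ^ 2 * (max (dist (q : E3) c₀) Y)⁻¹ ^ 8)

include hA hI in
/-- **The base values of the step field** (see the module docstring). [folklore] -/
theorem step_values (hκ0 : 0 < κ)
    (hκ : ∀ v : E3 → E3, (Function.support v).Finite →
      Function.support v ⊆ Sites₀ t A → κ * nnForm t A v ≤ ∑' p : Sites₀ t A, ⟪𝕃 v @ p, v p⟫)
    (v w : E3 → E3) (hv : (Function.support v).Finite) (hw : (Function.support w).Finite)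
    {ρ : ℝ} (hρ : 64 ≤ ρ)
    (hrows : ∀ p : Sites₀ t A, dist (p : E3) c₀ ≤ 2 * (1280 * (9 * ρ) + 2388) + 4 → 𝕃 (fun x => v x + w x) @ p = 0)
    {Msh Jv W : ℝ} (hMsh : 𝐌[v, 4 * (1280 * (9 * ρ) + 2388) + 4] ≤ Msh) (hJv : 𝐉[v, 10 * ρ + 10] ≤ Jv)
    (hWle : ∑' q : Sites₀ t A, ‖w q‖ ^ 2 ≤ W)
    {x : E3} (hx : x ∈ Sites₀ t A) (hxd : dist x c₀ ≤ ρ) :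
    ‖v x + w x‖ ≤ Real.sqrt (64 * 𝐋 ^ 3 / ρ ^ 3 * (2 * Msh + 2 * W) + 536 * 𝐋 ^ 3 * ρ ^ 3 * (2 * Jv + 2 * (10 * ρ + 10)⁻¹ ^ 8 * W)) := by
  have hh : (Function.support (fun x => v x + w x)).Finite := by
    refine (hv.union hw).subset fun x hx => ?_
    simp only [Function.mem_support, ne_eq, Set.mem_union] at hx ⊢
    by_contra h0
    push Not at h0
    exact hx (by rw [h0.1, h0.2, add_zero])
  have hsup := sup_sq_le_of_harmonic (c₀ := c₀) hA hI hκ0 hκ hh (R := ρ) (by linarith) (ρg := 2 * (1280 * (9 * ρ) + 2388) + 4)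
    (by linarith) hrows hx hxd
  have hY : (0 : ℝ) < 10 * ρ + 10 := by linarith
  have hM := mass_add_le (t := t) (A := A) (c₀ := c₀) hv hw (320 * ρ + 340)
  have hJ := farMass_add_le (t := t) (A := A) (c₀ := c₀) hv hw hY
  have hMv : 𝐌[v, 320 * ρ + 340] ≤ Msh := (mass_mono hA hI v (by linarith)).trans hMsh
  have hL0 : 0 ≤ 𝐋 := by positivity
  have hρ0 : 0 < ρ := by linarith
  refine Real.le_sqrt_of_sq_le (hsup.trans ?_)
  have h1 : 𝐌[(fun x => v x + w x), 320 * ρ + 340] ≤ 2 * Msh + 2 * W := by linarith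
  have h2 : 𝐉[(fun x => v x + w x), 10 * ρ + 10] ≤ 2 * Jv + 2 * (10 * ρ + 10)⁻¹ ^ 8 * W := by
    have h0 : 0 ≤ (10 * ρ + 10)⁻¹ ^ 8 := by positivity
    nlinarith [hJ, hJv, hWle, h0]
  gcongr

end

end Summit.AtomisticToContinuum.Crystallization.Theorems.ExcessDecayLiouville

end
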